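import Summits.KontsevichZagierPeriods.KontsevichZagierPeriods.Theorems.GrothendieckSectorComplementStubJointKernel
import Literature.NumberTheory.Transcendental.LindemannWeierstrassProofs

/-!
# The root of the `π`-tree: `evalP` is injective on `ℤ[ϖ]`
# (stub `stub_piLineKernel`, line `containment-join` (ring level), crux `Grothendieck.SectorComplement`,
# stmt-KontsevichZagierPeriods-11102)

In the formal period ring `P = FormalRep ⧸ relations` of the Kontsevich–Zagier calculus, Conjecture 1
on a sector is injectivity of the evaluation `evalP : P →+* ℝ` on a subring. This file lands the
ROOT of the `π`-tree: for the class `ϖ = ⟦[p]⟧` of any representation `p = [ℝ, 1/(1+x²)]` of `π`,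
`evalP` is injective on the subring `ℤ[ϖ] = range (Polynomial.aeval ϖ)`. Proof: `evalP ∘ aeval ϖ =
aeval (evalP ϖ) = aeval π` (`Polynomial.aeval_algHom_apply`, `value [p] = π`, `piRep_value`), and
`aeval π : ℤ[X] → ℝ` is injective because `π` is transcendental over `ℚ` (Lindemann,
`transcendental_pi_holds`, proved in the tree), hence over `ℤ` (`Transcendental.restrictScalars`);
so `evalP (aeval ϖ f) = 0` forces `f = 0`, hence `aeval ϖ f = 0`.

References: M. Kontsevich, D. Zagier, *Periods* (2001), §1.1, §4.1; F. Lindemann (1882).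
-/

noncomputable section

open MeasureTheory Set
open Literature.NumberTheory.Transcendental
open Literature.NumberTheory.Transcendental.KZ
open Summit.KontsevichZagierPeriods.Grothendieck.LemniscaticSectorGlue

namespace Summit.KontsevichZagierPeriods.Grothendieck.SectorComplementRingJoin

/-- **`π` is transcendental over `ℤ`**: Lindemann's theorem (`transcendental_pi_holds`,
`Transcendental ℚ π`) restricted along the injection `ℤ → ℚ`. [Lindemann 1882] -/
theorem transcendental_int_pi : Transcendental ℤ Real.pi :=
  Transcendental.restrictScalars (R := ℤ) (S := ℚ) (algebraMap ℤ ℚ).injective_int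
    transcendental_pi_holds

/-- **`evalP ∘ aeval ⟦[p]⟧ = aeval π` on `ℤ[X]`** for a representation `p = [ℝ, 1/(1+x²)]` of `π`:
both are ring maps `ℤ[X] → ℝ` with the same value on `X` (`evalP ⟦[p]⟧ = value [p] = π`,
`piRep_value`). [Kontsevich–Zagier 2001, §4.1] -/
theorem evalP_polynomial_aeval_piRep (p : IntegralRep 1) (hpd : p.domain = univ)
    (hpi : p.integrand = fun x => 1 / (1 + x 0 ^ 2)) (f : Polynomial ℤ) :
    evalP (Polynomial.aeval (toFormalPeriod (of p)) f) = Polynomial.aeval Real.pi f := by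
  rw [← piRep_value p hpd hpi, ← evalP_toFormalPeriod_of]
  exact (Polynomial.aeval_algHom_apply evalP.toIntAlgHom (toFormalPeriod (of p)) f).symm

/-- STUB S2c (registered `stub_piLineKernel`): **`evalP` is injective on `ℤ[ϖ]`** for the class
`ϖ = ⟦[p]⟧` of a representation `p = [ℝ, 1/(1+x²)]` of `π` — Lindemann's theorem
(`transcendental_pi_holds`) read in the formal period ring: `evalP (aeval ϖ f) = aeval π f`
(`evalP_polynomial_aeval_piRep`), and `aeval π` is injective on `ℤ[X]` (`transcendental_int_pi`,
`transcendental_iff_injective`), so `evalP (aeval ϖ f) = 0` forces `f = 0`. [Lindemann 1882] -/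
theorem stub_piLineKernel :
    ∀ (p : IntegralRep 1), p.domain = Set.univ → (p.integrand = fun x => 1 / (1 + x 0 ^ 2)) →
      ∀ f : Polynomial ℤ, evalP (Polynomial.aeval (toFormalPeriod (of p)) f) = 0 →
        Polynomial.aeval (toFormalPeriod (of p)) f = 0 := by
  intro p hpd hpi f hf
  rw [evalP_polynomial_aeval_piRep p hpd hpi] at hf
  have hf0 : f = 0 :=
    transcendental_iff_injective.mp transcendental_int_pi (by rw [hf, map_zero])
  rw [hf0, map_zero]

end Summit.KontsevichZagierPeriods.Grothendieck.SectorComplementRingJoin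

end
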